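import Mathlib
import Literature.Geometry.Symplectic.JNormalPushoff
import HarnessLib

/-!
# The projector onto the normal frame along the tangent line (Wendl 2020, App. B, §B.2.5)

Flat model, dimension four. In the proof of the representation formula (Wendl 2020, Thm B.23) the
Cauchy–Riemann inequality for the normal coordinate `η̃` of a branch difference
(`Literature.Geometry.Symplectic.NormalPushoff.norm_dbar_le_of_pushoff`, Prop. B.28) needs, at a
point `y` of the curve, a real-linear functional `P : ℂ × ℂ → ℂ` which KILLS the tangent line
`Dg(ℂ)` and INVERTS the normal frame `X_·(y)` (`P (X_w(y)) = w`), with `‖P‖` bounded uniformly as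
the point approaches the critical point. This file constructs it explicitly:

* `psi J v = ½ (v - i • J v)` is complex-linear from `(ℂ², J)` to `(ℂ², i)` (`psi_J`) and
  `‖psi J - 𝟙‖ ≤ ½ ‖J - i‖` (`norm_psi_sub_id_le`);
* with the complex `2 × 2` determinant `det2 a b = a₁ b₂ - a₂ b₁`, the functional
  `proj J t = det2 (psi J t, psi J ·) / det2 (psi J t, psi J e₂)` vanishes on the `J`-complex
  line through `t` (`proj_apply_of_holomorphic`: `P (A c) = 0` when `A i = J (A 1)`, `t = A 1`)
  and inverts the frame `X_w = Re w • e₂ + Im w • J e₂` (`proj_frame`);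
* **quantitative transversality** (`norm_proj_le_of_near`): if `‖J - i‖ ≤ 1/8` and the direction
  of `t ≠ 0` is within `1/32` of a unit multiple of `e₁ = (1,0)`, then the determinant is
  `≥ ‖t‖/2` in modulus and `‖proj J t‖ ≤ 5`.

Along a `J̃`-holomorphic curve `g(z) = zᵏ e₁ + O(|z|^{k+1})` in a chart adapted to `J̃`
(`J̃(0) = i`), both smallness conditions hold near the critical point although `Dg → 0`, which is
what makes the constant `M` of `‖∂̄ η̃‖ ≤ M ‖η̃‖` finite (Wendl 2020, §B.2.5).

Everything is proved; no named facts.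

## References

* C. Wendl, *Lectures on Contact 3-Manifolds, Holomorphic Curves and Intersection Theory*,
  Cambridge Tracts in Math. 220 (2020), App. B, Prop. B.28, Thm B.23 and §B.2.5. [Wendl2020]
* M. Micallef, B. White, *The structure of branch points in minimal surfaces and in
  pseudoholomorphic curves*, Ann. of Math. 141 (1995), §6. [MicallefWhite1995]
-/

noncomputable section

open Complex

namespace Literature.Geometry.Symplectic.TransverseProjector

/-! ### P1. The complex `2 × 2` determinant -/

/-- The complex determinant `det2 a b = a₁ b₂ - a₂ b₁` of two vectors of `ℂ × ℂ`. [folklore] -/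
def det2 (a b : ℂ × ℂ) : ℂ := a.1 * b.2 - a.2 * b.1

/-- Unfolding `det2`. [folklore] -/
theorem det2_apply (a b : ℂ × ℂ) : det2 a b = a.1 * b.2 - a.2 * b.1 := rfl

/-- `det2 a a = 0`. [folklore] -/
@[simp] theorem det2_self (a : ℂ × ℂ) : det2 a a = 0 := by simp [det2]; ring

/-- `det2 a (c • b) = c det2 a b`. [folklore] -/
theorem det2_smul_right (a b : ℂ × ℂ) (c : ℂ) : det2 a (c • b) = c * det2 a b := by
  simp [det2]; ring

/-- `det2 (c • a) b = c det2 a b`. [folklore] -/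
theorem det2_smul_left (a b : ℂ × ℂ) (c : ℂ) : det2 (c • a) b = c * det2 a b := by
  simp [det2]; ring

/-- `det2` is additive in the second slot. [folklore] -/
theorem det2_add_right (a b b' : ℂ × ℂ) : det2 a (b + b') = det2 a b + det2 a b' := by
  simp [det2]; ring

/-- `det2` is subtractive in each slot (bilinearity). [folklore] -/
theorem det2_sub_sub (a a' b b' : ℂ × ℂ) :
    det2 a b - det2 a' b' = det2 (a - a') b + det2 a' (b - b') := by
  simp [det2]; ring

/-- `‖det2 a b‖ ≤ 2 ‖a‖ ‖b‖` (sup norm on `ℂ × ℂ`). [folklore] -/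
theorem norm_det2_le (a b : ℂ × ℂ) : ‖det2 a b‖ ≤ 2 * ‖a‖ * ‖b‖ := by
  have h1 : ‖a.1‖ ≤ ‖a‖ := norm_fst_le a
  have h2 : ‖a.2‖ ≤ ‖a‖ := norm_snd_le a
  have h3 : ‖b.1‖ ≤ ‖b‖ := norm_fst_le b
  have h4 : ‖b.2‖ ≤ ‖b‖ := norm_snd_le b
  calc ‖det2 a b‖ = ‖a.1 * b.2 - a.2 * b.1‖ := rfl
    _ ≤ ‖a.1 * b.2‖ + ‖a.2 * b.1‖ := norm_sub_le _ _
    _ = ‖a.1‖ * ‖b.2‖ + ‖a.2‖ * ‖b.1‖ := by rw [norm_mul, norm_mul]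
    _ ≤ ‖a‖ * ‖b‖ + ‖a‖ * ‖b‖ := by gcongr
    _ = 2 * ‖a‖ * ‖b‖ := by ring

/-- `det2 (c e₁) e₂ = c`. [folklore] -/
theorem det2_e₁_e₂ (c : ℂ) : det2 (c • (((1 : ℂ), (0 : ℂ)) : ℂ × ℂ)) ((0 : ℂ), (1 : ℂ)) = c := by
  simp [det2]

/-- `det2 a ·` as a real-linear functional. [folklore] -/
def det2CLM (a : ℂ × ℂ) : ℂ × ℂ →L[ℝ] ℂ :=
  a.1 • ((ContinuousLinearMap.snd ℂ ℂ ℂ).restrictScalars ℝ) -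
    a.2 • ((ContinuousLinearMap.fst ℂ ℂ ℂ).restrictScalars ℝ)

/-- Unfolding `det2CLM`. [folklore] -/
@[simp] theorem det2CLM_apply (a b : ℂ × ℂ) : det2CLM a b = det2 a b := by
  simp [det2CLM, det2, smul_eq_mul]

/-- `‖det2CLM a‖ ≤ 2 ‖a‖`. [folklore] -/
theorem norm_det2CLM_le (a : ℂ × ℂ) : ‖det2CLM a‖ ≤ 2 * ‖a‖ := by
  refine ContinuousLinearMap.opNorm_le_bound _ (by positivity) fun b => ?_
  rw [det2CLM_apply]
  exact norm_det2_le a b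

/-! ### P2. The complex-linear identification `Ψ_J = ½ (𝟙 - i J)` -/

/-- `Ψ_J v = ½ (v - i • J v)`: complex-linear from `(ℂ², J)` to `(ℂ², i)` and equal to `𝟙` when
`J = i`. [cite: Wendl2020, App. B, §B.2.5] -/
def psi (J : ℂ × ℂ →L[ℝ] ℂ × ℂ) : ℂ × ℂ →L[ℝ] ℂ × ℂ :=
  (2 : ℝ)⁻¹ • (ContinuousLinearMap.id ℝ (ℂ × ℂ) - I • J)

/-- Unfolding `psi`. [folklore] -/
theorem psi_apply (J : ℂ × ℂ →L[ℝ] ℂ × ℂ) (v : ℂ × ℂ) :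
    psi J v = (2 : ℝ)⁻¹ • (v - I • J v) := by
  simp [psi]

variable {J : ℂ × ℂ →L[ℝ] ℂ × ℂ}

/-- **`Ψ_J` is complex-linear for `J`**: `Ψ_J (J v) = i • Ψ_J v` (using `J² = -1`). [folklore] -/
theorem psi_J (hJ2 : ∀ v, J (J v) = -v) (v : ℂ × ℂ) : psi J (J v) = I • psi J v := by
  rw [psi_apply, psi_apply, hJ2]
  ext <;> simp <;> ring_nf <;> simp [I_sq] <;> ring

/-- `Ψ_J (a • v + b • J v) = (a + b i) • Ψ_J v` for real `a, b`: real combinations of `v, Jv`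
become complex multiples. [folklore] -/
theorem psi_real_combination (hJ2 : ∀ v, J (J v) = -v) (a b : ℝ) (v : ℂ × ℂ) :
    psi J (a • v + b • J v) = ((a : ℂ) + b * I) • psi J v := by
  rw [map_add, (psi J).map_smul_of_tower, (psi J).map_smul_of_tower, psi_J hJ2, add_smul,
    mul_smul, Complex.coe_smul, Complex.coe_smul]

/-- `Ψ_J (Re w • v + Im w • J v) = w • Ψ_J v`. [folklore] -/
theorem psi_frame_combination (hJ2 : ∀ v, J (J v) = -v) (w : ℂ) (v : ℂ × ℂ) :
    psi J (w.re • v + w.im • J v) = w • psi J v := by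
  rw [psi_real_combination hJ2, re_add_im]

/-- `Ψ_J - 𝟙 = -½ i • (J - i)`, hence `‖Ψ_J - 𝟙‖ ≤ ½ ‖J - i‖`. [folklore] -/
theorem norm_psi_sub_id_le (J : ℂ × ℂ →L[ℝ] ℂ × ℂ) :
    ‖psi J - ContinuousLinearMap.id ℝ (ℂ × ℂ)‖ ≤
      2⁻¹ * ‖J - I • ContinuousLinearMap.id ℝ (ℂ × ℂ)‖ := by
  have hid : psi J - ContinuousLinearMap.id ℝ (ℂ × ℂ) =
      ((-(2 : ℝ)⁻¹ : ℝ) • I) • (J - I • ContinuousLinearMap.id ℝ (ℂ × ℂ)) := by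
    ext v <;> simp [psi_apply] <;> ring_nf <;> simp [I_sq] <;> ring
  rw [hid, norm_smul, norm_smul, norm_neg, norm_I, mul_one, Real.norm_of_nonneg (by norm_num)]

/-- `‖Ψ_J v - v‖ ≤ ½ ‖J - i‖ ‖v‖`. [folklore] -/
theorem norm_psi_apply_sub_le (J : ℂ × ℂ →L[ℝ] ℂ × ℂ) (v : ℂ × ℂ) :
    ‖psi J v - v‖ ≤ 2⁻¹ * ‖J - I • ContinuousLinearMap.id ℝ (ℂ × ℂ)‖ * ‖v‖ := by
  have : psi J v - v = (psi J - ContinuousLinearMap.id ℝ (ℂ × ℂ)) v := rfl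
  rw [this]
  exact ((psi J - ContinuousLinearMap.id ℝ (ℂ × ℂ)).le_opNorm v).trans
    (mul_le_mul_of_nonneg_right (norm_psi_sub_id_le J) (norm_nonneg _))

/-! ### P3. The projector -/

/-- **The projector** `P = det2 (Ψt, Ψ ·) / det2 (Ψt, Ψe₂)` killing the `J`-line through `t` and
inverting the frame `X_w = Re w • e₂ + Im w • J e₂`. [cite: Wendl2020, App. B, §B.2.5] -/
def proj (J : ℂ × ℂ →L[ℝ] ℂ × ℂ) (t : ℂ × ℂ) : ℂ × ℂ →L[ℝ] ℂ :=
  (det2 (psi J t) (psi J ((0 : ℂ), (1 : ℂ))))⁻¹ • (det2CLM (psi J t)).comp (psi J)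

/-- Unfolding `proj`. [folklore] -/
theorem proj_apply (J : ℂ × ℂ →L[ℝ] ℂ × ℂ) (t v : ℂ × ℂ) :
    proj J t v = (det2 (psi J t) (psi J ((0 : ℂ), (1 : ℂ))))⁻¹ * det2 (psi J t) (psi J v) := by
  simp [proj, smul_eq_mul]

/-- **`P` inverts the normal frame**: `P (Re w • e₂ + Im w • J e₂) = w` (when the determinant is
non-zero). [cite: Wendl2020, App. B, §B.2.5] -/
theorem proj_frame (hJ2 : ∀ v, J (J v) = -v) {t : ℂ × ℂ}
    (hdet : det2 (psi J t) (psi J ((0 : ℂ), (1 : ℂ))) ≠ 0) (w : ℂ) :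
    proj J t (w.re • (((0 : ℂ), (1 : ℂ)) : ℂ × ℂ) + w.im • J ((0 : ℂ), (1 : ℂ))) = w := by
  rw [proj_apply, psi_frame_combination hJ2, det2_smul_right, ← mul_assoc, mul_comm _ w, mul_assoc,
    inv_mul_cancel₀ hdet, mul_one]

/-- `P` inverts the normal frame of `Literature/Geometry/Symplectic/JNormalPushoff.lean`:
`P (X_w(x)) = w` for `J = Jt x`. [cite: Wendl2020, App. B, §B.2.5] -/
theorem proj_normalFrame {Jt : ℂ × ℂ → ℂ × ℂ →L[ℝ] ℂ × ℂ} {x : ℂ × ℂ}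
    (hJ2 : ∀ v, Jt x (Jt x v) = -v) {t : ℂ × ℂ}
    (hdet : det2 (psi (Jt x) t) (psi (Jt x) ((0 : ℂ), (1 : ℂ))) ≠ 0) (w : ℂ) :
    proj (Jt x) t (NormalPushoff.frame Jt x w) = w := by
  rw [NormalPushoff.frame_apply]
  exact proj_frame hJ2 hdet w

/-- **`P` kills the `J`-complex line through `t`**: if `A : ℂ → ℂ²` is `J`-holomorphic
(`A i = J (A 1)`) and `t = A 1`, then `P (A c) = 0` for every `c`.
[cite: Wendl2020, App. B, §B.2.5] -/
theorem proj_apply_of_holomorphic (hJ2 : ∀ v, J (J v) = -v) {A : ℂ →L[ℝ] ℂ × ℂ}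
    (hA : A I = J (A 1)) (c : ℂ) : proj J (A 1) (A c) = 0 := by
  have hc : A c = c.re • A 1 + c.im • J (A 1) := by
    have h1 : c = c.re • (1 : ℂ) + c.im • I := by simp [real_smul, re_add_im]
    conv_lhs => rw [h1]
    rw [map_add, A.map_smul, A.map_smul, hA]
  rw [proj_apply, hc, psi_frame_combination hJ2, det2_smul_right, det2_self, mul_zero, mul_zero]

/-- `‖P‖ ≤ 2 ‖Ψ t‖ ‖Ψ‖ / |det2 (Ψt, Ψe₂)|`. [folklore] -/
theorem norm_proj_le (J : ℂ × ℂ →L[ℝ] ℂ × ℂ) (t : ℂ × ℂ) :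
    ‖proj J t‖ ≤ ‖det2 (psi J t) (psi J ((0 : ℂ), (1 : ℂ)))‖⁻¹ * (2 * ‖psi J t‖ * ‖psi J‖) := by
  rw [proj, norm_smul, norm_inv]
  gcongr
  exact (ContinuousLinearMap.opNorm_comp_le _ _).trans
    (mul_le_mul_of_nonneg_right (norm_det2CLM_le _) (norm_nonneg _))

/-! ### P4. Quantitative transversality -/

/-- If the unit-scale direction `τ` is within `3/32` of `c e₁` (`|c| = 1`) and `e` is within
`1/16` of `e₂`, then `|det2 τ e| ≥ 1/2`. [folklore] -/
theorem half_le_norm_det2 {τ e : ℂ × ℂ} {c : ℂ} (hc : ‖c‖ = 1)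
    (hτ : ‖τ - c • (((1 : ℂ), (0 : ℂ)) : ℂ × ℂ)‖ ≤ 3 / 32)
    (he : ‖e - ((0 : ℂ), (1 : ℂ))‖ ≤ 1 / 16) : 1 / 2 ≤ ‖det2 τ e‖ := by
  set τ₀ : ℂ × ℂ := c • (((1 : ℂ), (0 : ℂ)) : ℂ × ℂ) with hτ₀
  set e₀ : ℂ × ℂ := ((0 : ℂ), (1 : ℂ)) with he₀
  have h0 : det2 τ₀ e₀ = c := det2_e₁_e₂ c
  have hτ₀n : ‖τ₀‖ = 1 := by
    rw [hτ₀, norm_smul, hc, one_mul]; simp [Prod.norm_def]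
  have hen : ‖e‖ ≤ 17 / 16 := by
    have : ‖e‖ ≤ ‖e - e₀‖ + ‖e₀‖ := norm_le_norm_sub_add e e₀
    have he₀n : ‖e₀‖ = 1 := by simp [he₀, Prod.norm_def]
    linarith
  have hdiff : ‖det2 τ e - c‖ ≤ 11 / 32 := by
    rw [← h0, det2_sub_sub]
    calc ‖det2 (τ - τ₀) e + det2 τ₀ (e - e₀)‖
        ≤ ‖det2 (τ - τ₀) e‖ + ‖det2 τ₀ (e - e₀)‖ := norm_add_le _ _
      _ ≤ 2 * ‖τ - τ₀‖ * ‖e‖ + 2 * ‖τ₀‖ * ‖e - e₀‖ := add_le_add (norm_det2_le _ _) (norm_det2_le _ _)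
      _ ≤ 2 * (3 / 32) * (17 / 16) + 2 * 1 * (1 / 16) := by rw [hτ₀n]; gcongr
      _ ≤ 11 / 32 := by norm_num
  have : ‖c‖ - ‖det2 τ e - c‖ ≤ ‖det2 τ e‖ := by
    have := norm_sub_norm_le c (c - det2 τ e)
    rw [sub_sub_cancel, norm_sub_rev] at this
    linarith
  linarith

/-- **Uniform bound for the projector near the critical point.** If `J² = -1`, `‖J - i‖ ≤ 1/8`,
`t ≠ 0` and the direction of `t` is within `1/32` of `c e₁` with `|c| = 1`, then
`|det2 (Ψt, Ψe₂)| ≥ ‖t‖/2 > 0` and `‖proj J t‖ ≤ 5`. [cite: Wendl2020, App. B, §B.2.5] -/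
theorem norm_proj_le_of_near (hJi : ‖J - I • ContinuousLinearMap.id ℝ (ℂ × ℂ)‖ ≤ 1 / 8)
    {t : ℂ × ℂ} (ht : t ≠ 0) {c : ℂ} (hc : ‖c‖ = 1)
    (hdir : ‖(‖t‖⁻¹ : ℝ) • t - c • (((1 : ℂ), (0 : ℂ)) : ℂ × ℂ)‖ ≤ 1 / 32) :
    ‖t‖ / 2 ≤ ‖det2 (psi J t) (psi J ((0 : ℂ), (1 : ℂ)))‖ ∧
      det2 (psi J t) (psi J ((0 : ℂ), (1 : ℂ))) ≠ 0 ∧ ‖proj J t‖ ≤ 5 := by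
  have htn : 0 < ‖t‖ := norm_pos_iff.2 ht
  set e₀ : ℂ × ℂ := ((0 : ℂ), (1 : ℂ)) with he₀
  have he₀n : ‖e₀‖ = 1 := by simp [he₀, Prod.norm_def]
  -- `Ψ` is close to the identity
  have hΨid : ‖psi J - ContinuousLinearMap.id ℝ (ℂ × ℂ)‖ ≤ 1 / 16 := by
    have := norm_psi_sub_id_le J; nlinarith [norm_nonneg (J - I • ContinuousLinearMap.id ℝ (ℂ × ℂ))]
  have hΨn : ‖psi J‖ ≤ 17 / 16 := by
    have : ‖psi J‖ ≤ ‖psi J - ContinuousLinearMap.id ℝ (ℂ × ℂ)‖ + ‖ContinuousLinearMap.id ℝ (ℂ × ℂ)‖ :=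
      norm_le_norm_sub_add _ _
    have hid : ‖ContinuousLinearMap.id ℝ (ℂ × ℂ)‖ ≤ 1 := ContinuousLinearMap.norm_id_le
    linarith
  have hΨv : ∀ v : ℂ × ℂ, ‖psi J v - v‖ ≤ 1 / 16 * ‖v‖ := fun v => by
    have := norm_psi_apply_sub_le J v
    calc ‖psi J v - v‖ ≤ 2⁻¹ * ‖J - I • ContinuousLinearMap.id ℝ (ℂ × ℂ)‖ * ‖v‖ := this
      _ ≤ 2⁻¹ * (1 / 8) * ‖v‖ := by gcongr
      _ = 1 / 16 * ‖v‖ := by ring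
  -- the frame vector
  have he : ‖psi J e₀ - e₀‖ ≤ 1 / 16 := by simpa [he₀n] using hΨv e₀
  -- the rescaled tangent vector
  set τ : ℂ × ℂ := (‖t‖⁻¹ : ℝ) • psi J t with hτ
  have hτt : psi J t = (‖t‖ : ℂ) • τ := by
    rw [hτ, ← Complex.coe_smul, smul_smul, ← Complex.ofReal_mul, mul_inv_cancel₀ htn.ne',
      Complex.ofReal_one, one_smul]
  have hτdir : ‖τ - c • (((1 : ℂ), (0 : ℂ)) : ℂ × ℂ)‖ ≤ 3 / 32 := by
    have h1 : ‖τ - (‖t‖⁻¹ : ℝ) • t‖ ≤ 1 / 16 := by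
      rw [hτ, ← smul_sub, norm_smul, norm_inv, Real.norm_of_nonneg htn.le]
      calc ‖t‖⁻¹ * ‖psi J t - t‖ ≤ ‖t‖⁻¹ * (1 / 16 * ‖t‖) := by gcongr; exact hΨv t
        _ = 1 / 16 := by field_simp
    calc ‖τ - c • (((1 : ℂ), (0 : ℂ)) : ℂ × ℂ)‖
        = ‖(τ - (‖t‖⁻¹ : ℝ) • t) + ((‖t‖⁻¹ : ℝ) • t - c • (((1 : ℂ), (0 : ℂ)) : ℂ × ℂ))‖ := by
          rw [sub_add_sub_cancel]
      _ ≤ ‖τ - (‖t‖⁻¹ : ℝ) • t‖ + ‖(‖t‖⁻¹ : ℝ) • t - c • (((1 : ℂ), (0 : ℂ)) : ℂ × ℂ)‖ :=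
          norm_add_le _ _
      _ ≤ 1 / 16 + 1 / 32 := add_le_add h1 hdir
      _ = 3 / 32 := by norm_num
  have hhalf : 1 / 2 ≤ ‖det2 τ (psi J e₀)‖ := half_le_norm_det2 hc hτdir he
  -- the determinant
  have hdet_eq : det2 (psi J t) (psi J e₀) = (‖t‖ : ℂ) * det2 τ (psi J e₀) := by
    rw [hτt, det2_smul_left]
  have hdet_ge : ‖t‖ / 2 ≤ ‖det2 (psi J t) (psi J e₀)‖ := by
    rw [hdet_eq, norm_mul, Complex.norm_real, Real.norm_of_nonneg htn.le]
    calc ‖t‖ / 2 = ‖t‖ * (1 / 2) := by ring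
      _ ≤ ‖t‖ * ‖det2 τ (psi J e₀)‖ := by gcongr
  have hdet_pos : 0 < ‖det2 (psi J t) (psi J e₀)‖ := lt_of_lt_of_le (by positivity) hdet_ge
  have hdet_ne : det2 (psi J t) (psi J e₀) ≠ 0 := norm_pos_iff.1 hdet_pos
  refine ⟨hdet_ge, hdet_ne, ?_⟩
  -- the norm of the projector
  have hΨt : ‖psi J t‖ ≤ 17 / 16 * ‖t‖ := by
    calc ‖psi J t‖ ≤ ‖psi J‖ * ‖t‖ := (psi J).le_opNorm t
      _ ≤ 17 / 16 * ‖t‖ := by gcongr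
  calc ‖proj J t‖ ≤ ‖det2 (psi J t) (psi J e₀)‖⁻¹ * (2 * ‖psi J t‖ * ‖psi J‖) := norm_proj_le J t
    _ ≤ (‖t‖ / 2)⁻¹ * (2 * (17 / 16 * ‖t‖) * (17 / 16)) := by
        gcongr
    _ = 289 / 64 := by field_simp; ring
    _ ≤ 5 := by norm_num

end Literature.Geometry.Symplectic.TransverseProjector

end
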